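import Literature.AnabelianGeometry.EtaleTheta.ThetaSubquotientOfTemperedTwist
import Literature.AnabelianGeometry.EtaleTheta.ThetaSubquotientOfTemperedAut

/-!
# [EtTh] §5: the twist of `(l·Δ_Θ)_E` along a compatible automorphism AGREES with print's subquotient of `Aut` —
# `twist ∘ autProj_E = autProj_{B^temp(φ)(E)} ∘ B^temp(φ)` (T56-L03 step 2, the `P`-free half)

Mochizuki, *The étale theta function and its Frobenioid-theoretic manifestations*, Publ. RIMS **45** (2009), §5 p.327 (PDF p.101):
«these subquotients determine subquotients `Aut_D(D) ↠ Aut^Θ_D(D)`; `(l·Δ_Θ)_D ⊆ Aut^Θ_D(D)` which are preserved by arbitrary self-equivalences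
of `D`»; Thm. 5.6 proof p.329 (PDF p.103) l.1 and l.17–21 (the Δ-transport of `Ψ` and the base transport `θ` of `Aut_D(B_N^bs)` are induced by
the same outer automorphism) [cite: MochizukiEtTh2009, §5 p.327 (PDF p.101)].

abc-iut cell, layer L2, seat abc-iut-w5-d013 (gen 4), ROW «T56-L03 step 2 — P-free half» (STATUS 2026-08-26T10:36:11Z).  PROOF-ONLY over
`ThetaSubquotientOfTemperedTwist.lean` (this seat, p437689: `ThetaSubquotient.twist`) and abc-iut-L2-t9's `ThetaSubquotientOfTemperedAut.lean`
(`autPre`, `autProj`, `evalAt_autProj`) / `…Galois.lean` (`evalAt`, `evalAt_injective`); nothing there is edited.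
* `ThetaSubquotient.mapIso_res_mem_autPre` — an automorphism `σ` of `E` acting through `q⁻¹(L)` (print's `Aut` «given by `l·Δ_Θ`»), viewed as
  an automorphism `B^temp(φ)(σ)` of the twisted object (same underlying map), again acts through `q⁻¹(L)`: at `x`, `σ = n·(−)` becomes
  `φ⁻¹(n)·(−)` for the twisted action, and `q(φ⁻¹ n) = φQ⁻¹ q(n) ∈ L`;
* `ThetaSubquotient.evalAt_twist_mk` — evaluation of a twisted class at a point: `[φΛ⁻¹ (t x)]`;
* **`ThetaSubquotient.twist_autProj`** — for connected `B^temp(φ)(E)` (e.g. `E` connected, `φ` surjective) and `σ ∈ autPre E`: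
  `twist (autProj_E σ) = autProj_{B^temp(φ)E} (B^temp(φ)(σ))`.  This is the carrier-level content of T56-L09c
  (`Thm56Sub.DeltaTransportCompat`): the Δ-transport defined by the twist and the transport of `Aut_D(−)` induced by `Ψ^bs ≅ B^temp(φ)`
  agree on print's subquotient.  What remains for T56-L09c at the genuine §5 data is bookkeeping through the identifications
  `(Ψ A)^bs ≅ Ψ^bs(A^bs) ≅ B^temp(φ)(A^bs)` and a `ThetaSubquotientProj` at `B_N^bs` (the (Q,P) packaging, GAP G-w4d042g3-1).
HONEST FRAMING: kernel-checked lemmas about abc-iut-L2-t9's carrier; nothing about the curves of [EtTh] is asserted; no side taken on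
[IUTchIII] Cor. 3.12.
-/

noncomputable section

namespace Literature.AnabelianGeometry.EtaleTheta

namespace ThetaSubquotient

open CategoryTheory Literature.AlgebraicGeometry.Frobenioids Literature.AnabelianGeometry.SemiGraphs
open Literature.AlgebraicGeometry.Frobenioids.QuasiTemperoid (stabilizerSubgroup)
open Literature.AlgebraicGeometry.Frobenioids.QuasiTemperoid.BTempConnected (nonempty_of_isConnectedObj)

universe u v w

variable {G : Type u} [Group G] [TopologicalSpace G] {Q : Type v} [Group Q] {Λ : Type w}
  [CommGroup Λ] (q : G →* Q) (ι : Λ →* Q)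
  (φ : G ≃ₜ* G) (φQ : Q ≃* Q) (φΛ : Λ ≃* Λ) (hq : ∀ g : G, q (φ g) = φQ (q g)) (hι : ∀ a : Λ, ι (φΛ a) = φQ (ι a))

include hq hι in
/-- **Automorphisms «given by `l·Δ_Θ`» stay such under the twist**: if `σ ∈ Aut(E)` acts at every point through `q⁻¹(L)`, so does
`B^temp(φ)(σ) ∈ Aut(B^temp(φ)(E))` (same underlying map; at `x`, `n ↦ φ⁻¹ n`, `q(φ⁻¹ n) = φQ⁻¹ q(n) = ι(φΛ⁻¹ a)`).
[cite: MochizukiEtTh2009, §5 p.327 (PDF p.101)] -/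
theorem mapIso_res_mem_autPre (E : BTemp G) {σ : Aut E} (hσ : σ ∈ autPre q ι E) :
    (BTemp.res (φ : G →ₜ* G)).mapIso σ ∈ autPre q ι ((BTemp.res (φ : G →ₜ* G)).obj E) := by
  intro x
  obtain ⟨n, ⟨a, ha⟩, hx⟩ := hσ x
  refine ⟨φ.symm n, ⟨φΛ.symm a, ?_⟩, ?_⟩
  · apply φQ.injective
    rw [← hι, MulEquiv.apply_symm_apply, ← hq, ContinuousMulEquiv.apply_symm_apply]
    exact ha
  · change ((σ : Aut E).hom.hom.hom x : E.obj.V) = E.obj.ρ ((φ : G →ₜ* G) (φ.symm n)) x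
    rw [hx]
    exact congrArg (fun m => (E.obj.ρ m x : E.obj.V)) (φ.apply_symm_apply n).symm

variable [ι.range.Normal]

/-- Evaluation of a twisted class at a point: `[φΛ⁻¹ (t x)]` (definitional). [cite: MochizukiEtTh2009, §5 p.327 (PDF p.101)] -/
theorem evalAt_twist_mk (E : BTemp G) (t : Fam q ι E) (x : E.obj.V) :
    evalAt q ι ((BTemp.res (φ : G →ₜ* G)).obj E) x (twist q ι φ φQ φΛ hq hι E (mk q ι E t)) =
      QuotientGroup.mk (φΛ.symm ((t : E.obj.V → Λ) x)) := rfl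

/-- **The twist agrees with print's subquotient of `Aut`**: for `σ ∈ autPre E` and `B^temp(φ)(E)` connected,
`twist (autProj_E σ) = autProj_{B^temp(φ)(E)} (B^temp(φ)(σ))` — the Δ-transport of `(l·Δ_Θ)_(−)` along a self-equivalence
`Ψ^bs ≅ B^temp(φ)` and the induced transport of `Aut_D(−)` coincide on `Aut`'s subquotient (the carrier-level content of T56-L09c).
[cite: MochizukiEtTh2009, Thm 5.6 proof p.329 (PDF p.103); §5 p.327 (PDF p.101)] -/
theorem twist_autProj (E : BTemp G) (hEr : IsConnectedObj ((BTemp.res (φ : G →ₜ* G)).obj E)) (σ : autPre q ι E) :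
    twist q ι φ φQ φΛ hq hι E (autProj q ι E σ) =
      autProj q ι ((BTemp.res (φ : G →ₜ* G)).obj E)
        ⟨(BTemp.res (φ : G →ₜ* G)).mapIso (σ : Aut E), mapIso_res_mem_autPre q ι φ φQ φΛ hq hι E σ.2⟩ := by
  obtain ⟨x⟩ := nonempty_of_isConnectedObj _ hEr
  change E.obj.V at x
  apply evalAt_injective q ι hEr x
  -- `σ` acts at `x` by `n`, `q n = ι a`
  obtain ⟨n, ⟨a, ha⟩, hx⟩ := σ.2 x
  have ha' : ι (φΛ.symm a) = q (φ.symm n) := by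
    apply φQ.injective
    rw [← hι, MulEquiv.apply_symm_apply, ← hq, ContinuousMulEquiv.apply_symm_apply]
    exact ha
  -- the right-hand side evaluates to `[φΛ⁻¹ a]` (`B^temp(φ)(σ)` acts at `x` by `φ⁻¹ n` for the twisted action)
  rw [evalAt_autProj q ι _ ⟨_, mapIso_res_mem_autPre q ι φ φQ φΛ hq hι E σ.2⟩ x (φ.symm n) (φΛ.symm a) ha' (by
    change ((σ : Aut E).hom.hom.hom x : E.obj.V) = E.obj.ρ ((φ : G →ₜ* G) (φ.symm n)) x
    rw [hx]
    exact congrArg (fun m => (E.obj.ρ m x : E.obj.V)) (φ.apply_symm_apply n).symm)]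
  -- the left-hand side: `autProj σ = [t]` with `[t x] = [a]`, and the twisted class evaluates to `[φΛ⁻¹ (t x)]`
  have h1 := evalAt_autProj q ι E σ x n a ha hx
  obtain ⟨t, ht⟩ := QuotientGroup.mk_surjective (autProj q ι E σ)
  rw [← ht] at h1 ⊢
  change QuotientGroup.mk ((t : E.obj.V → Λ) x) = QuotientGroup.mk a at h1
  change QuotientGroup.mk (φΛ.symm ((t : E.obj.V → Λ) x)) = (QuotientGroup.mk (φΛ.symm a) : Carrier q ι _)
  rw [QuotientGroup.eq, Subgroup.mem_comap, map_mul, map_inv] at h1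
  rw [QuotientGroup.eq, Subgroup.mem_comap, mem_killQ_res_iff q ι φ φQ φΛ hq hι, ← map_inv, ← map_mul, ← hι,
    MulEquiv.apply_symm_apply, map_mul, map_inv]
  exact h1

end ThetaSubquotient

end Literature.AnabelianGeometry.EtaleTheta

end
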